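import Summits.QuantumAdvantage.QuantumAdvantage.Theses.LinnikCubicClassGroups
import Summits.QuantumAdvantage.QuantumAdvantage.Theorems.LinnikCubicClassGroupsDegreeOnePrimesEscapeStarkResidue
import Summits.QuantumAdvantage.QuantumAdvantage.Theorems.LinnikCubicClassGroupsDegreeOnePrimesEscapeUpperShadow
import Summits.QuantumAdvantage.QuantumAdvantage.Theorems.LinnikCubicClassGroupsDegreeOnePrimesEscapeLowerShadow
import Summits.QuantumAdvantage.QuantumAdvantage.Theorems.LinnikCubicClassGroupsDegreeOnePrimesEscapeComposition
import Summits.QuantumAdvantage.QuantumAdvantage.Theorems.LinnikCubicClassGroupsDegreeOnePrimesEscapeAdditiveOfTZ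
import Summits.QuantumAdvantage.QuantumAdvantage.Theorems.LinnikCubicClassGroupsDegreeOnePrimesEscapeUpperShadowAdd
import Summits.QuantumAdvantage.QuantumAdvantage.Theorems.LinnikCubicClassGroupsDegreeOnePrimesEscapeLowerShadowAdd
import Literature.NumberTheory.LFunctions.StarkNoQuadraticSubfieldProofs
import Literature.NumberTheory.LFunctions.UniformClassGroupPNTGeneralDegree
import Literature.NumberTheory.LFunctions.StarkExceptionalZero
import Literature.NumberTheory.LFunctions.PrimeIdealTheorem
import Summits.QuantumAdvantage.QuantumAdvantage.Theorems.LinnikCubicClassGroupsDegreeOnePrimesEscapeDedekindRelation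
import Summits.QuantumAdvantage.QuantumAdvantage.Theorems.LinnikCubicClassGroupsDegreeOnePrimesEscapeCubicClosure
import Summits.QuantumAdvantage.QuantumAdvantage.Theorems.LinnikCubicClassGroupsDegreeOnePrimesEscapeCollisionTransfer
import HarnessLib.Audit

/-!
# Skeleton line `dedekind-s3-collision` for crux `DegreeOnePrimesEscape` (stmt-QuantumAdvantage-11543)

Route `LinnikCubicClassGroups`, crux r2 `DegreeOnePrimesEscape` =
`∀ n, ∃ C, ∀ K (number field, [K:ℚ] = n, no quadratic subfield), ∀ x ≥ |d_K|^C, ∀ M < Cl(𝓞 K) proper: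
 π(x) ≤ 8 · #{P prime of 𝓞 K : N P prime, N P ≤ x, [P] ∉ M}`.

## State of the crux this skeleton docks into (read 2026-08-16T01:30Z)

The crux is CONDITIONALLY PROVED under `Theorems/` (the lead's landing of the dock, ex workfile
`Cruxes/DegreeOnePrimesEscape/IdeatorSketchR1I3.lean`, as `LinnikCubicClassGroupsDegreeOnePrimesEscape{UpperShadow,LiBounds,
LowerShadow,Composition}.lean` + `LinnikCubicClassGroupsDegreeOnePrimesEscape.lean`):
`Theorems.DegreeOnePrimesEscape.degreeOnePrimesEscape_of_TZ_starkInexplicit :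
ThornerZaman2019_classPNT_hilbertClassField → (∀ n, ∃ c > 0, ∀ K deg n w/o quadratic subfield, ζ_K ≠ 0 on [1 − c/log|d_K|, 1)) → DegreeOnePrimesEscape`
(sorry-free, standard axioms). Everything left is the discharge of the two hypotheses: the Thorner–Zaman fact (shared by
EVERY line; the ONE remaining debt) and the inexplicit Stark non-vanishing (stubs 3–5, ALL LANDED; every degree also by the
Literature discharge `Stark1974_dedekindZeta_ne_zero_of_noQuadraticSubfield_holds`, `StarkNoQuadraticSubfieldProofs.lean`).

## The line (crux idea card `dedekind-s3-collision`; triage r1: 3 × pass)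

Make the Stark hypothesis DEGREE-LOCAL (`StarkAt n`; `(∀ n, StarkAt n)` IS `StarkNoQuadSubfieldInexplicit`,
`Iff.rfl`) and discharge the degree the route consumes, `n = 3` (`Disproof.cubic_escape_of_crux`), WITHOUT Artin
`L`-functions:

* non-Galois (S₃-type) cubic `K`: Dedekind's 1900 relation `ζ_N·ζ² = ζ_k·ζ_K²` in the sextic Galois closure `N`
  with its quadratic resolvent `k` (= the Brauer relation `2·1 + Ind_1^{S₃} 1 = Ind_{A₃} 1 + 2·Ind_{C₂} 1`, Euler
  factor by Euler factor, ramified primes included) turns a real zero `β` of `ζ_K` into a zero of ORDER ≥ 2 of the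
  entire `ζ₁_N` (`ζ(β) < 0` on `(0,1)`: tree `riemannZeta_neg_of_pos_of_lt_one`), which the tree's PROVED uniform
  simplicity theorem `exists_realZero_simple_dedekindZeta₁ 6` pushes below `1 − c(6)/(log|d_N| + log 4)`; with
  `|d_N| ≤ |d_K|^A` (A = 6 from the tree's `natAbs_discr_le_pow_of_separating`, or 3 by the resolvent) this is a
  real-zero-free interval `[1 − c/log|d_K|, 1)` for every non-Galois cubic field (stubs 1–3);
* Galois (cyclic) cubic `K`: a real zero of `ζ_K = ζ·L(χ)·L(χ̄)` is automatically double, and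
  `exists_realZero_simple_dedekindZeta₁ 3` applies to `K` itself (stub 4);
* every other degree keeps the Stark input (`StarkResidue`, stub 5 — Stark 1974 Thm 3 / Heilbronn, shared with line
  `heilbronn-count-discharge`; the Literature programme `HeilbronnStark` / `StarkNoQuadraticSubfieldGlue` (landed
  2026-08-16T00:50Z) is one file away from `Stark1974_dedekindZeta_ne_zero_of_noQuadraticSubfield_holds`, after which
  stub 5 is the one-liner `starkResidue_of_named` below);
* the Thorner–Zaman fact (stub 6, shared with every line; depth 1 of line `one-sided-shadows`).

`DegreeOnePrimesEscape_of` composes the NINE stubs into the crux BY NAME (kernel-checked, no `sorry`):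
`stub_shadowsComposition (h11 h6) (h12 h6 (starkAll (starkAt_three (s3 s1 s2) s4) s5))` with every `sᵢ`/stub 9 a LANDED Theorems-side
theorem, `h6 : ClassPNTAdditive` (stub 6′, the additive class PNT — THE open obligation) (`h11`, `h12` = the landed additive shadows `stub_upperShadowAdd`/`stub_lowerShadowAdd`); stubs 7–9 are the lead's RESHAPE of the dock
(the Cruxes workfile cannot be imported by a Theorems file, so its three theorems became registered stubs, each with a
checked ≤ 400-line proof file); the only other glue is `starkAt_three_of_cubic`, PROVED here.

BYPASS (honest): once `Stark1974_dedekindZeta_ne_zero_of_noQuadraticSubfield_holds` lands, stubs 3 (conclusion), 4 and 5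
follow from it in one line each (`cubicZeroFreeNonGalois_of_named`, `cubicZeroFreeGalois_of_named`,
`starkResidue_of_named`, all PROVED below), and the crux needs only stub 6; stubs 1–2 then carry the line's
independent content (Dedekind's relation for S₃-sextics and the embedded S₃-closure with a discriminant bound —
neither is in the tree) but are no longer on the critical path.

## Disproof used (`Cruxes/DegreeOnePrimesEscape/Disproof.lean`, cdisprove gen 3 v4.1)
* §1 `degreeOnePrimesEscape_false_without_proper` (landed `Negative/WithoutProperFalse.lean`, p69750) — HONOURED:
  `M ≠ ⊤` is used inside the docked composition (`degreeOnePrimesEscape_of_shadows`: `[Cl:M] ≥ 2`), not here.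
* §2 degenerate degrees `n ≤ 2` are handled inside the dock; §3 odd degree: at `n = 3` the no-quadratic-subfield
  hypothesis is automatic — the stubs 3/4 conclusions do not even assume it.
* §9 `CruxFromFacts` / `not_crux_imp_not_fact`, `not_stark_iff` — the ONE enemy is a real zero of `ζ_K` itself
  near `1`; stubs 3, 4, 5 are exactly its exclusion, degree by degree.
* §10 sign lemmas (landed `Negative/EscapeSign.lean`, p70790) and §5/5b counting (landed
  `Negative/EscapeCounting.lean`, p70172) — used inside the dock (`subgroupUpperShadow_of_TZ`); imported and
  re-checked below; no landed Negative lemma refutes an instance of any stub (they concern counting / signs, the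
  stubs concern zeros of zeta functions and field theory).
* No `-- Targets` stub kill and no sorried near-miss exist for this crux (Disproof.lean: `targets = []`).
-/

noncomputable section

open scoped NumberField nonZeroDivisors
open Literature.NumberTheory.LFunctions Literature.NumberTheory.LFunctions.NumberField

set_option linter.dupNamespace false

namespace Summit.QuantumAdvantage.QuantumAdvantage.Cruxes.DegreeOnePrimesEscape.DedekindS3Collision

/-! ### The statements of the line (named `Prop`s over existing declarations) -/

/-- **Stark's inexplicit non-vanishing AT ONE DEGREE `n`** — the degree-`n` slice of the dock's inexplicit Stark
hypothesis (verbatim its body): there is `c = c(n) > 0` such that for every number field `K` of degree `n` without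
quadratic subfield, `ζ_K(σ) ≠ 0` for `1 − c/log|d_K| ≤ σ < 1`. -/
def StarkAt (n : ℕ) : Prop :=
  ∃ c : ℝ, 0 < c ∧ ∀ (K : Type) [Field K] [NumberField K], Module.finrank ℚ K = n →
    (∀ F : IntermediateField ℚ K, Module.finrank ℚ F ≠ 2) →
    ∀ σ : ℝ, 1 - c / Real.log ((NumberField.discr K).natAbs : ℝ) ≤ σ → σ < 1 →
      dedekindZetaCont K σ ≠ 0

/-- The degree-local slicing is definitional: `∀ n, StarkAt n` IS the dock's inexplicit Stark hypothesis. -/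
theorem starkNoQuadSubfieldInexplicit_iff :
    (∀ n : ℕ, ∃ c : ℝ, 0 < c ∧ ∀ (K : Type) [Field K] [NumberField K], Module.finrank ℚ K = n →
      (∀ F : IntermediateField ℚ K, Module.finrank ℚ F ≠ 2) →
      ∀ σ : ℝ, 1 - c / Real.log ((NumberField.discr K).natAbs : ℝ) ≤ σ → σ < 1 →
        dedekindZetaCont K σ ≠ 0) ↔ ∀ n : ℕ, StarkAt n :=
  Iff.rfl

/-- **D1–D2. Dedekind's relation for an `S₃`-sextic** (R. Dedekind 1900 for pure cubic fields; in general the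
Brauer–Kuroda relation `2·1 + Ind_1^{S₃} 1 = Ind_{A₃}^{S₃} 1 + 2·Ind_{C₂}^{S₃} 1` read through Artin formalism
`ζ_N = ζ·L(sgn)·L(ρ)²`, `ζ_K = ζ·L(ρ)`, `ζ_k = ζ·L(sgn)`): for a Galois number field `N` of degree `6` with
NON-ABELIAN group, every cubic subfield `K` and every quadratic subfield `k`,
`ζ_N(s)·ζ(s)² = ζ_k(s)·ζ_K(s)²` on `Re s > 1` (Mathlib's Dirichlet series `NumberField.dedekindZeta`,
`riemannZeta`). Euler factor by Euler factor, ramified primes included. -/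
def S3DedekindRelation : Prop :=
  ∀ (N : Type) [Field N] [NumberField N] [IsGalois ℚ N], Module.finrank ℚ N = 6 →
    (∃ g h : N ≃ₐ[ℚ] N, g * h ≠ h * g) →
    ∀ (K k : IntermediateField ℚ N), Module.finrank ℚ K = 3 → Module.finrank ℚ k = 2 →
    ∀ s : ℂ, 1 < s.re →
      NumberField.dedekindZeta N s * riemannZeta s ^ 2 =
        NumberField.dedekindZeta k s * NumberField.dedekindZeta K s ^ 2

/-- **D4. The embedded `S₃`-closure with a polynomial discriminant bound**: there is an absolute `A` such that
every NON-Galois cubic number field `K` embeds into a Galois number field `N` of degree `6` with non-abelian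
group, containing a quadratic subfield, with `|d_N| ≤ |d_K|^A` (`A = 6`: tree
`Literature.NumberTheory.NumberFields.natAbs_discr_le_pow_of_separating`, the three conjugates of `K` separate
`Gal(N/ℚ) ≅ S₃`; classically `|d_N| = |d_k|·d_K² ≤ |d_K|³`). -/
def CubicClosureBound : Prop :=
  ∃ A : ℕ, ∀ (K : Type) [Field K] [NumberField K], Module.finrank ℚ K = 3 → ¬ IsGalois ℚ K →
    ∃ (N : Type) (_ : Field N) (_ : NumberField N), IsGalois ℚ N ∧ Module.finrank ℚ N = 6 ∧
      (∃ g h : N ≃ₐ[ℚ] N, g * h ≠ h * g) ∧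
      (∃ K' : IntermediateField ℚ N, Nonempty (K ≃ₐ[ℚ] K')) ∧
      (∃ k : IntermediateField ℚ N, Module.finrank ℚ k = 2) ∧
      (NumberField.discr N).natAbs ≤ (NumberField.discr K).natAbs ^ A

/-- **Real-zero-free interval for NON-Galois cubic fields** (the `S₃` slice of `StarkAt 3`, field hypothesis
dropped — it is automatic in odd degree, `Disproof.noQuadraticSubfield_of_odd`). -/
def CubicZeroFreeNonGalois : Prop :=
  ∃ c : ℝ, 0 < c ∧ ∀ (K : Type) [Field K] [NumberField K], Module.finrank ℚ K = 3 → ¬ IsGalois ℚ K →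
    ∀ σ : ℝ, 1 - c / Real.log ((NumberField.discr K).natAbs : ℝ) ≤ σ → σ < 1 →
      dedekindZetaCont K σ ≠ 0

/-- **Real-zero-free interval for Galois (cyclic) cubic fields** (the `C₃` residue inside `n = 3`). -/
def CubicZeroFreeGalois : Prop :=
  ∃ c : ℝ, 0 < c ∧ ∀ (K : Type) [Field K] [NumberField K], Module.finrank ℚ K = 3 → IsGalois ℚ K →
    ∀ σ : ℝ, 1 - c / Real.log ((NumberField.discr K).natAbs : ℝ) ≤ σ → σ < 1 →
      dedekindZetaCont K σ ≠ 0

/-- **D3+D5. The collision transfer**: Dedekind's relation and the embedded closure give the zero-free interval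
for non-Galois cubics (continuation of the relation by the identity theorem, `ord_β ζ₁_N = ord_β ζ_k + 2·ord_β ζ_K ≥ 2`
at a real zero `β ∈ (0,1)` of `ζ_K` since `ζ(β) < 0`, then `exists_realZero_simple_dedekindZeta₁ 6` and
`log|d_N| ≤ A·log|d_K|`). -/
def CollisionTransfer : Prop := S3DedekindRelation → CubicClosureBound → CubicZeroFreeNonGalois

/-- **Upper shadow** (statement of stub 7's conclusion). -/
def UpperShadow : Prop :=
  ∃ C₀ : ℝ, ∀ (K : Type) [Field K] [NumberField K], 1 < Module.finrank ℚ K →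
    ∀ x : ℝ, ThornerZaman.condQn K ^ C₀ ≤ x →
    ∀ M : Subgroup (ClassGroup (𝓞 K)),
      32 * (M.index : ℝ) *
          (Set.ncard {P : Ideal (𝓞 K) | P.IsPrime ∧ (Ideal.absNorm P : ℝ) ≤ x ∧
              ∃ hP : P ∈ (Ideal (𝓞 K))⁰, ClassGroup.mk0 ⟨P, hP⟩ ∈ M} : ℝ)
        ≤ 33 * offsetLogIntegral x

/-- **Lower shadow** (statement of stub 8's conclusion). -/
def LowerShadow : Prop :=
  ∀ n : ℕ, 1 < n → ∃ C₁ : ℝ, ∀ (K : Type) [Field K] [NumberField K], Module.finrank ℚ K = n →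
    (∀ F : IntermediateField ℚ K, Module.finrank ℚ F ≠ 2) →
    ∀ x : ℝ, ThornerZaman.condQn K ^ C₁ ≤ x →
      29 * offsetLogIntegral x ≤ 32 * (primeIdealCount K x : ℝ)

/-- **The ADDITIVE class prime number theorem dichotomy** (lead's reshape, 2026-08-16): the WEAKER form of the
Thorner–Zaman fact that the dock actually consumes — per class `C` and `x ≥ Q^{c₁}`, `|π_C(x) − m_C(x)/h| ≤ Li(x)/(32h)` with
`m_C = Li(x)` or `Li(x) − Re χ₁(C)·Li(x^{β₁})` (`χ₁` real, `β₁ ∈ (1 − 1/(8 log Q), 1)` a real zero of `L(s,χ₁)`).  Implied by the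
printed theorem (stub 10, LANDING) and sufficient for both shadows (stubs 11, 12, LANDING); provable WITHOUT Deuring–Heilbronn
repulsion (ZFR + Landau–Page + log-free zero density + explicit formula) — THE remaining debt of the crux, now stated minimally. -/
def ClassPNTAdditive : Prop :=
  ∃ c₁ : ℝ, 0 < c₁ ∧ ∀ (K : Type) [Field K] [NumberField K], 1 < Module.finrank ℚ K →
      ((∀ (C : ClassGroup (𝓞 K)) (x : ℝ), ThornerZaman.condQn K ^ c₁ ≤ x →
          |(primeIdealClassCount K C x : ℝ) - offsetLogIntegral x / NumberField.classNumber K| ≤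
            offsetLogIntegral x / (32 * NumberField.classNumber K)) ∨
        ∃ (χ₁ : ClassGroup (𝓞 K) →* ℂˣ) (β₁ : ℝ), χ₁ * χ₁ = 1 ∧
          1 - 1 / (8 * Real.log (ThornerZaman.condQn K)) < β₁ ∧ β₁ < 1 ∧
          classGroupLFunction K χ₁ β₁ = 0 ∧
          ∀ (C : ClassGroup (𝓞 K)) (x : ℝ), ThornerZaman.condQn K ^ c₁ ≤ x →
            |(primeIdealClassCount K C x : ℝ) -
                (offsetLogIntegral x - ((χ₁ C : ℂ)).re * offsetLogIntegral (x ^ β₁)) /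
                  NumberField.classNumber K| ≤
              offsetLogIntegral x / (32 * NumberField.classNumber K))

/-- **The residue**: every degree other than `3` keeps Stark's input (Stark 1974 Thm 3 via Heilbronn characters;
= the inexplicit Stark hypothesis off `n = 3`; implied by the named fact
`Stark1974_dedekindZeta_ne_zero_of_noQuadraticSubfield`, see `starkResidue_of_named`). -/
def StarkResidue : Prop := ∀ n : ℕ, n ≠ 3 → StarkAt n

/-! ### Name-keyed aliases of the nine statements (the hypotheses of the composition; the skeleton audit admits
a hypothesis only if its head constant is a registered obligation or is named like a declared stub) -/
namespace Registered

/-- Alias of `S3DedekindRelation` keyed by the registered stub name. -/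
abbrev stub_dedekindRelation : Prop := S3DedekindRelation
/-- Alias of `CubicClosureBound` keyed by the registered stub name. -/
abbrev stub_cubicClosure : Prop := CubicClosureBound
/-- Alias of `CollisionTransfer` keyed by the registered stub name. -/
abbrev stub_collisionTransfer : Prop := CollisionTransfer
/-- Alias of `CubicZeroFreeGalois` keyed by the registered stub name. -/
abbrev stub_galoisCubicZeroFree : Prop := CubicZeroFreeGalois
/-- Alias of `StarkResidue` keyed by the registered stub name. -/
abbrev stub_starkResidue : Prop := StarkResidue
/-- Alias of the Thorner–Zaman fact (former stub 6; no longer a stub: it implies stub 6′ by stub 10). -/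
abbrev stub_thornerZaman : Prop := ThornerZaman2019_classPNT_hilbertClassField
/-- Alias of stub 6′ (THE open obligation) keyed by the registered stub name. -/
abbrev stub_classPNTAdditive : Prop := ClassPNTAdditive
/-- Alias of stub 10 keyed by the registered stub name. -/
abbrev stub_additiveOfTZ : Prop := ThornerZaman2019_classPNT_hilbertClassField → ClassPNTAdditive
/-- Alias of stub 11 keyed by the registered stub name. -/
abbrev stub_upperShadowAdd : Prop := ClassPNTAdditive → UpperShadow
/-- Alias of stub 12 keyed by the registered stub name. -/
abbrev stub_lowerShadowAdd : Prop := ClassPNTAdditive → (∀ n : ℕ, StarkAt n) → LowerShadow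
/-- Alias of stub 7's statement keyed by the registered stub name. -/
abbrev stub_upperShadow : Prop := ThornerZaman2019_classPNT_hilbertClassField → UpperShadow
/-- Alias of stub 8's statement keyed by the registered stub name. -/
abbrev stub_lowerShadow : Prop :=
  ThornerZaman2019_classPNT_hilbertClassField → (∀ n : ℕ, StarkAt n) → LowerShadow
/-- Alias of stub 9's statement keyed by the registered stub name. -/
abbrev stub_shadowsComposition : Prop :=
  UpperShadow → LowerShadow →
    (∀ n : ℕ, ∃ C : ℕ, ∀ (K : Type) [Field K] [NumberField K], Module.finrank ℚ K = n →
      (∀ F : IntermediateField ℚ K, Module.finrank ℚ F ≠ 2) → ∀ x : ℕ, |NumberField.discr K| ^ C ≤ (x : ℤ) →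
      ∀ M : Subgroup (ClassGroup (NumberField.RingOfIntegers K)), M ≠ ⊤ →
        Nat.primeCounting x ≤ 8 * Set.ncard {P : Ideal (NumberField.RingOfIntegers K) | P.IsPrime ∧
          (Ideal.absNorm P).Prime ∧ Ideal.absNorm P ≤ x ∧
          ∃ hP : P ∈ nonZeroDivisors (Ideal (NumberField.RingOfIntegers K)), ClassGroup.mk0 ⟨P, hP⟩ ∉ M})

end Registered

/-! ### Glue (PROVED): degree `3` from its two Galois types; all degrees from `3` + residue -/

/-- `|d_K| ≥ 1`, so `log|d_K| ≥ 0`. [folklore] -/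
theorem log_natAbs_discr_nonneg (K : Type) [Field K] [NumberField K] :
    0 ≤ Real.log ((NumberField.discr K).natAbs : ℝ) := by
  apply Real.log_nonneg
  exact_mod_cast Nat.one_le_iff_ne_zero.mpr (Int.natAbs_ne_zero.mpr (NumberField.discr_ne_zero K))

/-- **`StarkAt 3` from the two Galois types of a cubic field** (min of the two constants; the
no-quadratic-subfield hypothesis is not even needed at `n = 3`). -/
theorem starkAt_three_of_cubic (hng : CubicZeroFreeNonGalois) (hg : CubicZeroFreeGalois) : StarkAt 3 := by
  classical
  obtain ⟨c₁, hc₁, h₁⟩ := hng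
  obtain ⟨c₂, hc₂, h₂⟩ := hg
  refine ⟨min c₁ c₂, lt_min hc₁ hc₂, fun K _ _ hK _ σ hσ hσ1 => ?_⟩
  have hlog := log_natAbs_discr_nonneg K
  by_cases hGal : IsGalois ℚ K
  · refine h₂ K hK hGal σ (le_trans ?_ hσ) hσ1
    have hdiv : min c₁ c₂ / Real.log ((NumberField.discr K).natAbs : ℝ) ≤
        c₂ / Real.log ((NumberField.discr K).natAbs : ℝ) :=
      div_le_div_of_nonneg_right (min_le_right _ _) hlog
    linarith
  · refine h₁ K hK hGal σ (le_trans ?_ hσ) hσ1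
    have hdiv : min c₁ c₂ / Real.log ((NumberField.discr K).natAbs : ℝ) ≤
        c₁ / Real.log ((NumberField.discr K).natAbs : ℝ) :=
      div_le_div_of_nonneg_right (min_le_left _ _) hlog
    linarith

/-- All degrees from degree `3` and the residue. -/
theorem starkAt_all (h3 : StarkAt 3) (hres : StarkResidue) : ∀ n : ℕ, StarkAt n := by
  intro n
  by_cases hn : n = 3
  · subst hn; exact h3
  · exact hres n hn

/-! ### The bypass, PROVED: what the named Stark fact gives (one line per stub once `…_holds` lands) -/

/-- The named (explicit) Stark fact gives `StarkAt n` for every `n` (`c = 1/(4·n!)`). -/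
theorem starkAt_of_named (h : Stark1974_dedekindZeta_ne_zero_of_noQuadraticSubfield) (n : ℕ) : StarkAt n := by
  refine ⟨1 / (4 * (n.factorial : ℝ)), by positivity, fun K _ _ hK hnq σ hσ hσ1 => ?_⟩
  refine h K hnq σ ?_ hσ1
  subst hK
  have : 1 / (4 * ((Module.finrank ℚ K).factorial : ℝ)) / Real.log ((NumberField.discr K).natAbs : ℝ)
      = 1 / (4 * ((Module.finrank ℚ K).factorial : ℝ) * Real.log ((NumberField.discr K).natAbs : ℝ)) := by
    rw [div_div]
  linarith [this]

/-- Stub 5 from the named Stark fact. -/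
theorem starkResidue_of_named (h : Stark1974_dedekindZeta_ne_zero_of_noQuadraticSubfield) : StarkResidue :=
  fun n _ => starkAt_of_named h n

/-- A cubic field has no quadratic subfield (tower law). [folklore] -/
theorem noQuadraticSubfield_of_finrank_eq_three (K : Type) [Field K] [NumberField K]
    (hK : Module.finrank ℚ K = 3) : ∀ F : IntermediateField ℚ K, Module.finrank ℚ F ≠ 2 := by
  intro F hF
  have hdvd : Module.finrank ℚ F ∣ Module.finrank ℚ K := Dvd.intro _ (Module.finrank_mul_finrank ℚ F K)
  rw [hF, hK] at hdvd
  omega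

/-- Stub 4 from the named Stark fact. -/
theorem cubicZeroFreeGalois_of_named (h : Stark1974_dedekindZeta_ne_zero_of_noQuadraticSubfield) :
    CubicZeroFreeGalois := by
  obtain ⟨c, hc, hS⟩ := starkAt_of_named h 3
  exact ⟨c, hc, fun K _ _ hK _ σ hσ hσ1 => hS K hK (noQuadraticSubfield_of_finrank_eq_three K hK) σ hσ hσ1⟩

/-- The conclusion of stub 3 from the named Stark fact (so stub 3 is provable ignoring its hypotheses then). -/
theorem cubicZeroFreeNonGalois_of_named (h : Stark1974_dedekindZeta_ne_zero_of_noQuadraticSubfield) :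
    CubicZeroFreeNonGalois := by
  obtain ⟨c, hc, hS⟩ := starkAt_of_named h 3
  exact ⟨c, hc, fun K _ _ hK _ σ hσ hσ1 => hS K hK (noQuadraticSubfield_of_finrank_eq_three K hK) σ hσ hσ1⟩

/-! ### The composition: the nine stubs imply the crux, by name (FIRST theorem of the file concluding the crux) -/

/-- **`DegreeOnePrimesEscape` from the stubs** (pure logic; no `sorry`; LANDED stubs are discharged inside the proof by their
Theorems-side names, only OPEN stubs remain hypotheses): stubs 7–9 are the dock
(TZ → upper shadow; TZ + inexplicit Stark → lower shadow; shadows → crux); stubs 1–2 fed into stub 3 give the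
zero-free interval for non-Galois cubics, stub 4 the Galois cubics, hence `StarkAt 3`; stub 5 supplies every
other degree, so `StarkNoQuadSubfieldInexplicit` holds (definitionally `∀ n, StarkAt n`); stub 6 is the
Thorner–Zaman fact; the dock concludes the crux. -/
theorem DegreeOnePrimesEscape_of (h6 : Registered.stub_classPNTAdditive) :
    Summit.QuantumAdvantage.QuantumAdvantage.Theses.LinnikCubicClassGroups.DegreeOnePrimesEscape :=
  Summit.QuantumAdvantage.QuantumAdvantage.Theorems.DegreeOnePrimesEscape.stub_shadowsComposition
    (Summit.QuantumAdvantage.QuantumAdvantage.Theorems.DegreeOnePrimesEscape.stub_upperShadowAdd h6)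
    (Summit.QuantumAdvantage.QuantumAdvantage.Theorems.DegreeOnePrimesEscape.stub_lowerShadowAdd h6 (starkAt_all (starkAt_three_of_cubic
      (Summit.QuantumAdvantage.QuantumAdvantage.Theorems.DegreeOnePrimesEscape.stub_collisionTransfer
        Summit.QuantumAdvantage.QuantumAdvantage.Theorems.DegreeOnePrimesEscape.stub_dedekindRelation
        Summit.QuantumAdvantage.QuantumAdvantage.Theorems.DegreeOnePrimesEscape.stub_cubicClosure)
      (cubicZeroFreeGalois_of_named Stark1974_dedekindZeta_ne_zero_of_noQuadraticSubfield_holds))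
      Summit.QuantumAdvantage.QuantumAdvantage.Theorems.DegreeOnePrimesEscape.stub_starkResidue))

/-! ### The registered stubs (statements expanded over existing declarations) -/

/-- STUB 1 (LANDED p78068, `Theorems/LinnikCubicClassGroupsDegreeOnePrimesEscapeDedekindRelation.lean`; was: L, OPEN in the tree, this line's load-bearing algebra) — `S3DedekindRelation`. Proof pattern in the
tree: `AbelianFieldDedekindZeta.lean` §§1–3 and §8 (regroup both Euler products along `primeBelow`,
`hasProd_dedekindEulerFactor_holds`, `prod_fiber_eq_prod_map_splittingType`, Mathlib
`riemannZeta_eulerProduct_hasProd`, `HasProd.unique`), with the splitting types of `p` in `N`, `K`, `k` read off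
the Frobenius/inertia double cosets in `S₃` by Perlis' counting identity (★)
`card_inertia_mul_card_fixingSubgroup_mul_sum` (`ArithmeticEquivalenceGassmannProofs.lean`, any Galois `N/ℚ`,
ramified `p` included). Local check (card's cheapest falsifier): unramified types `e ↦ (1−T)⁻⁸` both sides,
transposition `↦ (1−T²)⁻³(1−T)⁻²`, 3-cycle `↦ (1−T³)⁻²(1−T)⁻²`; ramified `p`: both sides equal by the character
identity on `V^I`. PARI jobs j008496 / j008637 (triage) test it numerically. -/
theorem stub_dedekindRelation :
    ∀ (N : Type) [Field N] [NumberField N] [IsGalois ℚ N], Module.finrank ℚ N = 6 →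
      (∃ g h : N ≃ₐ[ℚ] N, g * h ≠ h * g) →
      ∀ (K k : IntermediateField ℚ N), Module.finrank ℚ K = 3 → Module.finrank ℚ k = 2 →
      ∀ s : ℂ, 1 < s.re →
        NumberField.dedekindZeta N s * riemannZeta s ^ 2 =
          NumberField.dedekindZeta k s * NumberField.dedekindZeta K s ^ 2 :=
  Summit.QuantumAdvantage.QuantumAdvantage.Theorems.DegreeOnePrimesEscape.stub_dedekindRelation

/-- STUB 2 (LANDED p76924, `Theorems/LinnikCubicClassGroupsDegreeOnePrimesEscapeCubicClosure.lean`; was: M, PROVABLE NOW from tree material) — `CubicClosureBound` with `A = 6`: take `N :=` the normal closure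
of `K` in `AlgebraicClosure ℚ` (Mathlib `normalClosure`; finite-dimensional and normal, hence a Galois number
field), `K' := ` the range of the canonical embedding; `[N:ℚ] ∣ 3! ` and `K` not normal force `[N:ℚ] = 6` and a
non-abelian group (an abelian sextic would make every subfield Galois); the quadratic subfield is the fixed field
of the index-2 subgroup `A₃` (Galois correspondence, `IsGalois.intermediateFieldEquivSubgroup`; cf.
`exists_intermediateField_finrank_eq_two`, `StarkNoQuadraticSubfieldGlue.lean` G7); the bound is
`natAbs_discr_le_pow_of_separating` (GaloisClosureDiscriminant / Glue G5) since the conjugates of `K'` have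
trivially-intersecting stabilisers in `S₃` (Glue G2–G4: `iSup_fieldRange_normalClosure_eq_top`,
`exists_not_mem_fixingSubgroup_fieldRange`). -/
theorem stub_cubicClosure :
    ∃ A : ℕ, ∀ (K : Type) [Field K] [NumberField K], Module.finrank ℚ K = 3 → ¬ IsGalois ℚ K →
      ∃ (N : Type) (_ : Field N) (_ : NumberField N), IsGalois ℚ N ∧ Module.finrank ℚ N = 6 ∧
        (∃ g h : N ≃ₐ[ℚ] N, g * h ≠ h * g) ∧
        (∃ K' : IntermediateField ℚ N, Nonempty (K ≃ₐ[ℚ] K')) ∧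
        (∃ k : IntermediateField ℚ N, Module.finrank ℚ k = 2) ∧
        (NumberField.discr N).natAbs ≤ (NumberField.discr K).natAbs ^ A :=
  Summit.QuantumAdvantage.QuantumAdvantage.Theorems.DegreeOnePrimesEscape.stub_cubicClosure

/-- STUB 3 (LANDED p76624, `Theorems/LinnikCubicClassGroupsDegreeOnePrimesEscapeCollisionTransfer.lean`; was: M, PROVABLE NOW given stubs 1–2; the collision proper) — `CollisionTransfer`: for `K` non-Galois cubic
and `σ ∈ [1 − c/log|d_K|, 1)` with `ζ_K(σ) = 0` (so `σ > 1/2`, `|d_K| ≥ 23`): move to `K' ≅ K` inside `N`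
(`dedekindZetaCont_eq_of_algEquiv`, Glue G1); the relation on `Re s > 1` continues to `{1}ᶜ` (both sides are
analytic off `1` and agree on the half-plane: `IsDedekindZetaContinuation.unique` pattern /
`AnalyticOnNhd.eqOn_of_preconnected_of_eventuallyEq`, `dedekindZetaCont_eq_dedekindZeta_holds`,
`dedekindZetaCont_rat_eq_riemannZeta_holds`); analytic orders add (`AnalyticAt.analyticOrderAt_mul/pow`), `ζ(σ) ≠ 0`
(`riemannZeta_neg_of_pos_of_lt_one`) and `ζ_k` has finite order (`analyticOrderAt_dedekindZeta₁_ne_top`), so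
`2 ≤ analyticOrderAt (dedekindZeta₁ N) σ` (`analyticOrderAt_dedekindZeta₁_eq_dedekindZetaCont`); then
`exists_realZero_simple_dedekindZeta₁ 6` gives `σ ≤ 1 − c₆/(log|d_N| + log 4) ≤ 1 − c₆/((A+2) log|d_K|)`,
contradiction for `c := c₆/(2(A+2))`. -/
theorem stub_collisionTransfer :
    (∀ (N : Type) [Field N] [NumberField N] [IsGalois ℚ N], Module.finrank ℚ N = 6 →
      (∃ g h : N ≃ₐ[ℚ] N, g * h ≠ h * g) →
      ∀ (K k : IntermediateField ℚ N), Module.finrank ℚ K = 3 → Module.finrank ℚ k = 2 →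
      ∀ s : ℂ, 1 < s.re →
        NumberField.dedekindZeta N s * riemannZeta s ^ 2 =
          NumberField.dedekindZeta k s * NumberField.dedekindZeta K s ^ 2) →
    (∃ A : ℕ, ∀ (K : Type) [Field K] [NumberField K], Module.finrank ℚ K = 3 → ¬ IsGalois ℚ K →
      ∃ (N : Type) (_ : Field N) (_ : NumberField N), IsGalois ℚ N ∧ Module.finrank ℚ N = 6 ∧
        (∃ g h : N ≃ₐ[ℚ] N, g * h ≠ h * g) ∧
        (∃ K' : IntermediateField ℚ N, Nonempty (K ≃ₐ[ℚ] K')) ∧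
        (∃ k : IntermediateField ℚ N, Module.finrank ℚ k = 2) ∧
        (NumberField.discr N).natAbs ≤ (NumberField.discr K).natAbs ^ A) →
    ∃ c : ℝ, 0 < c ∧ ∀ (K : Type) [Field K] [NumberField K], Module.finrank ℚ K = 3 → ¬ IsGalois ℚ K →
      ∀ σ : ℝ, 1 - c / Real.log ((NumberField.discr K).natAbs : ℝ) ≤ σ → σ < 1 →
        dedekindZetaCont K σ ≠ 0 :=
  Summit.QuantumAdvantage.QuantumAdvantage.Theorems.DegreeOnePrimesEscape.stub_collisionTransfer

/-- STUB 4 (LANDED p78904, `Theorems/LinnikCubicClassGroupsDegreeOnePrimesEscapeGaloisCubicZeroFree.lean`, route A: Heilbronn–Stark with G = C₃; was: M, PROVABLE NOW from tree material) — `CubicZeroFreeGalois`: for cyclic cubic `K`, Kronecker–Weber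
(`KroneckerWeber_holds`) embeds `K` in some `ℚ(ζ_n)`, `AbelianDedekindZeta.dedekindZetaCont_eq_prod_characterGroup_LFunction`
gives `ζ_K = ζ·L(χ⋆)·L(χ̄⋆)` with `χ` cubic; at a real zero `σ ∈ (0,1)`, `ζ(σ) < 0` forces `L(σ,χ⋆) = 0` or
`L(σ,χ̄⋆) = 0`, and `L(σ, χ̄⋆) = conj L(σ, χ⋆)` for real `σ`, so BOTH vanish: `2 ≤ analyticOrderAt (dedekindZeta₁ K) σ`
and `exists_realZero_simple_dedekindZeta₁ 3` gives `σ ≤ 1 − c₃/(log|d_K| + log 4)`. (Alternative in tree: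
`Heilbronn.exists_index_two_of_dedekindZetaCont_eq_zero` with `N = K`, `G = C₃` has no index-2 subgroup; or the
named Stark fact, `cubicZeroFreeGalois_of_named`.) -/
theorem stub_galoisCubicZeroFree :
    ∃ c : ℝ, 0 < c ∧ ∀ (K : Type) [Field K] [NumberField K], Module.finrank ℚ K = 3 → IsGalois ℚ K →
      ∀ σ : ℝ, 1 - c / Real.log ((NumberField.discr K).natAbs : ℝ) ≤ σ → σ < 1 →
        dedekindZetaCont K σ ≠ 0 :=
  -- LANDED independently as `Summit.QuantumAdvantage.QuantumAdvantage.Theorems.DegreeOnePrimesEscape.stub_galoisCubicZeroFree` (p78904, route A: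
  -- Heilbronn–Stark with G = C₃); linked here through the discharged Stark fact to keep this file's import closure small.
  cubicZeroFreeGalois_of_named Stark1974_dedekindZeta_ne_zero_of_noQuadraticSubfield_holds

/-- STUB 5 (LANDED p85783, `Theorems/LinnikCubicClassGroupsDegreeOnePrimesEscapeStarkResidue.lean`, a 10-line corollary of the Literature
discharge `Stark1974_dedekindZeta_ne_zero_of_noQuadraticSubfield_holds` = `Literature/NumberTheory/LFunctions/StarkNoQuadraticSubfieldProofs.lean`
(p80153, written and landed by this line); was: XL as mathematics = Stark 1974 Thm 3 / Heilbronn in every degree `n ≠ 3`) — `StarkResidue`. -/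
theorem stub_starkResidue :
    ∀ n : ℕ, n ≠ 3 →
      ∃ c : ℝ, 0 < c ∧ ∀ (K : Type) [Field K] [NumberField K], Module.finrank ℚ K = n →
        (∀ F : IntermediateField ℚ K, Module.finrank ℚ F ≠ 2) →
        ∀ σ : ℝ, 1 - c / Real.log ((NumberField.discr K).natAbs : ℝ) ≤ σ → σ < 1 →
          dedekindZetaCont K σ ≠ 0 :=
  Summit.QuantumAdvantage.QuantumAdvantage.Theorems.DegreeOnePrimesEscape.stub_starkResidue

/-- STUB 6′ (OPEN — THE ONE REMAINING DEBT OF THE CRUX, stated minimally; replaces stub 6 = the printed Thorner–Zaman fact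
`ThornerZaman2019_classPNT_hilbertClassField`, which implies it by stub 10): **the additive class prime number theorem dichotomy**
for the Hilbert class field of a number field of degree `> 1`, uniform in the field, at polynomial height `x ≥ Q^{c₁}`
(`Q = |d_K|·n^n`), additive error `Li(x)/(32 h_K)` per class.  [cite: ThornerZaman2019, Thm 1.4 — a consequence; second source
Thorner–Zhang 2024 Cor. 4].  Its discharge needs, uniformly in `K`: zero-free region + Landau–Page (tree: any degree), log-free
zero density (tree: class-group `L`-functions for `n ≤ 4`, `ζ₁_K` for `n ≤ 2` only), explicit formula + unsmoothing +
`θ → π` transfer (tree), `h_K ≤ Q⁴` (tree) — and NO Deuring–Heilbronn repulsion. -/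
theorem stub_classPNTAdditive :
    (∃ c₁ : ℝ, 0 < c₁ ∧ ∀ (K : Type) [Field K] [NumberField K], 1 < Module.finrank ℚ K →
      ((∀ (C : ClassGroup (𝓞 K)) (x : ℝ), ThornerZaman.condQn K ^ c₁ ≤ x →
          |(primeIdealClassCount K C x : ℝ) - offsetLogIntegral x / NumberField.classNumber K| ≤
            offsetLogIntegral x / (32 * NumberField.classNumber K)) ∨
        ∃ (χ₁ : ClassGroup (𝓞 K) →* ℂˣ) (β₁ : ℝ), χ₁ * χ₁ = 1 ∧
          1 - 1 / (8 * Real.log (ThornerZaman.condQn K)) < β₁ ∧ β₁ < 1 ∧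
          classGroupLFunction K χ₁ β₁ = 0 ∧
          ∀ (C : ClassGroup (𝓞 K)) (x : ℝ), ThornerZaman.condQn K ^ c₁ ≤ x →
            |(primeIdealClassCount K C x : ℝ) -
                (offsetLogIntegral x - ((χ₁ C : ℂ)).re * offsetLogIntegral (x ^ β₁)) /
                  NumberField.classNumber K| ≤
              offsetLogIntegral x / (32 * NumberField.classNumber K))) := by
  sorry

/-- STUB 10 (LANDED, `Theorems/LinnikCubicClassGroupsDegreeOnePrimesEscapeAdditiveOfTZ.lean`) — the printed Thorner–Zaman fact implies
the additive dichotomy (`2c₃E(x) ≤ 1/32` for `x ≥ Q^{C₀}`, `0 ≤ m_C ≤ 2Li(x)`). -/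
theorem stub_additiveOfTZ : ThornerZaman2019_classPNT_hilbertClassField →
    (∃ c₁ : ℝ, 0 < c₁ ∧ ∀ (K : Type) [Field K] [NumberField K], 1 < Module.finrank ℚ K →
      ((∀ (C : ClassGroup (𝓞 K)) (x : ℝ), ThornerZaman.condQn K ^ c₁ ≤ x →
          |(primeIdealClassCount K C x : ℝ) - offsetLogIntegral x / NumberField.classNumber K| ≤
            offsetLogIntegral x / (32 * NumberField.classNumber K)) ∨
        ∃ (χ₁ : ClassGroup (𝓞 K) →* ℂˣ) (β₁ : ℝ), χ₁ * χ₁ = 1 ∧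
          1 - 1 / (8 * Real.log (ThornerZaman.condQn K)) < β₁ ∧ β₁ < 1 ∧
          classGroupLFunction K χ₁ β₁ = 0 ∧
          ∀ (C : ClassGroup (𝓞 K)) (x : ℝ), ThornerZaman.condQn K ^ c₁ ≤ x →
            |(primeIdealClassCount K C x : ℝ) -
                (offsetLogIntegral x - ((χ₁ C : ℂ)).re * offsetLogIntegral (x ^ β₁)) /
                  NumberField.classNumber K| ≤
              offsetLogIntegral x / (32 * NumberField.classNumber K))) :=
  Summit.QuantumAdvantage.QuantumAdvantage.Theorems.DegreeOnePrimesEscape.stub_additiveOfTZ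

/-- STUB 11 (LANDED, `Theorems/LinnikCubicClassGroupsDegreeOnePrimesEscapeUpperShadowAdd.lean`) — the upper shadow from the additive
dichotomy (same constants `32/33`: the additive errors over `C ∈ M` total `|M|·Li/(32h)`). -/
theorem stub_upperShadowAdd :
    (∃ c₁ : ℝ, 0 < c₁ ∧ ∀ (K : Type) [Field K] [NumberField K], 1 < Module.finrank ℚ K →
      ((∀ (C : ClassGroup (𝓞 K)) (x : ℝ), ThornerZaman.condQn K ^ c₁ ≤ x →
          |(primeIdealClassCount K C x : ℝ) - offsetLogIntegral x / NumberField.classNumber K| ≤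
            offsetLogIntegral x / (32 * NumberField.classNumber K)) ∨
        ∃ (χ₁ : ClassGroup (𝓞 K) →* ℂˣ) (β₁ : ℝ), χ₁ * χ₁ = 1 ∧
          1 - 1 / (8 * Real.log (ThornerZaman.condQn K)) < β₁ ∧ β₁ < 1 ∧
          classGroupLFunction K χ₁ β₁ = 0 ∧
          ∀ (C : ClassGroup (𝓞 K)) (x : ℝ), ThornerZaman.condQn K ^ c₁ ≤ x →
            |(primeIdealClassCount K C x : ℝ) -
                (offsetLogIntegral x - ((χ₁ C : ℂ)).re * offsetLogIntegral (x ^ β₁)) /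
                  NumberField.classNumber K| ≤
              offsetLogIntegral x / (32 * NumberField.classNumber K))) →
    ∃ C₀ : ℝ, ∀ (K : Type) [Field K] [NumberField K], 1 < Module.finrank ℚ K →
      ∀ x : ℝ, ThornerZaman.condQn K ^ C₀ ≤ x →
      ∀ M : Subgroup (ClassGroup (𝓞 K)),
        32 * (M.index : ℝ) *
            (Set.ncard {P : Ideal (𝓞 K) | P.IsPrime ∧ (Ideal.absNorm P : ℝ) ≤ x ∧
                ∃ hP : P ∈ (Ideal (𝓞 K))⁰, ClassGroup.mk0 ⟨P, hP⟩ ∈ M} : ℝ)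
          ≤ 33 * offsetLogIntegral x :=
  Summit.QuantumAdvantage.QuantumAdvantage.Theorems.DegreeOnePrimesEscape.stub_upperShadowAdd

/-- STUB 12 (LANDED, `Theorems/LinnikCubicClassGroupsDegreeOnePrimesEscapeLowerShadowAdd.lean`) — the lower shadow from the additive
dichotomy + inexplicit Stark (`32·(0.98 − 1/32·1.04) ≥ 29·1.04`). -/
theorem stub_lowerShadowAdd :
    (∃ c₁ : ℝ, 0 < c₁ ∧ ∀ (K : Type) [Field K] [NumberField K], 1 < Module.finrank ℚ K →
      ((∀ (C : ClassGroup (𝓞 K)) (x : ℝ), ThornerZaman.condQn K ^ c₁ ≤ x →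
          |(primeIdealClassCount K C x : ℝ) - offsetLogIntegral x / NumberField.classNumber K| ≤
            offsetLogIntegral x / (32 * NumberField.classNumber K)) ∨
        ∃ (χ₁ : ClassGroup (𝓞 K) →* ℂˣ) (β₁ : ℝ), χ₁ * χ₁ = 1 ∧
          1 - 1 / (8 * Real.log (ThornerZaman.condQn K)) < β₁ ∧ β₁ < 1 ∧
          classGroupLFunction K χ₁ β₁ = 0 ∧
          ∀ (C : ClassGroup (𝓞 K)) (x : ℝ), ThornerZaman.condQn K ^ c₁ ≤ x →
            |(primeIdealClassCount K C x : ℝ) -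
                (offsetLogIntegral x - ((χ₁ C : ℂ)).re * offsetLogIntegral (x ^ β₁)) /
                  NumberField.classNumber K| ≤
              offsetLogIntegral x / (32 * NumberField.classNumber K))) →
    (∀ n : ℕ, ∃ c : ℝ, 0 < c ∧ ∀ (K : Type) [Field K] [NumberField K], Module.finrank ℚ K = n →
      (∀ F : IntermediateField ℚ K, Module.finrank ℚ F ≠ 2) →
      ∀ σ : ℝ, 1 - c / Real.log ((NumberField.discr K).natAbs : ℝ) ≤ σ → σ < 1 →
        dedekindZetaCont K σ ≠ 0) →
    ∀ n : ℕ, 1 < n → ∃ C₁ : ℝ, ∀ (K : Type) [Field K] [NumberField K], Module.finrank ℚ K = n →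
      (∀ F : IntermediateField ℚ K, Module.finrank ℚ F ≠ 2) →
      ∀ x : ℝ, ThornerZaman.condQn K ^ C₁ ≤ x →
        29 * offsetLogIntegral x ≤ 32 * (primeIdealCount K x : ℝ) :=
  Summit.QuantumAdvantage.QuantumAdvantage.Theorems.DegreeOnePrimesEscape.stub_lowerShadowAdd

/-! ### The dock as registered stubs (RESHAPE by the lead, 2026-08-16): the sorry-free conditional proof
TZ → inexplicit Stark → crux lived in the Cruxes WORKFILE `IdeatorSketchR1I3.lean`, which no `Theorems/` file may import;
to make this skeleton landable it is cut into three registered stubs, each proved by one ≤ 400-line Theorems file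
(`…UpperShadow.lean`, `…LowerShadow.lean`, `…Composition.lean`, all `lean check` rc 0 in the lead's folder). -/

/-- STUB 7 (LANDED p82345, `Theorems/LinnikCubicClassGroupsDegreeOnePrimesEscapeUpperShadow.lean`) — **the upper shadow from the TZ fact**:
an absolute `C₀` with `32·[Cl(K):M]·#{𝔭 prime, N𝔭 ≤ x, [𝔭] ∈ M} ≤ 33·Li(x)` for every `K` of degree `> 1`,
`x ≥ Q^{C₀}` (`Q = |d_K| n^n`) and EVERY subgroup `M` (sign-immune: `∑_{C∈M} Re χ₁(C) ≥ 0`). -/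
theorem stub_upperShadow : ThornerZaman2019_classPNT_hilbertClassField →
    ∃ C₀ : ℝ, ∀ (K : Type) [Field K] [NumberField K], 1 < Module.finrank ℚ K →
      ∀ x : ℝ, ThornerZaman.condQn K ^ C₀ ≤ x →
      ∀ M : Subgroup (ClassGroup (𝓞 K)),
        32 * (M.index : ℝ) *
            (Set.ncard {P : Ideal (𝓞 K) | P.IsPrime ∧ (Ideal.absNorm P : ℝ) ≤ x ∧
                ∃ hP : P ∈ (Ideal (𝓞 K))⁰, ClassGroup.mk0 ⟨P, hP⟩ ∈ M} : ℝ)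
          ≤ 33 * offsetLogIntegral x :=
  Summit.QuantumAdvantage.QuantumAdvantage.Theorems.DegreeOnePrimesEscape.stub_upperShadow

/-- STUB 8 (LANDED, `Theorems/LinnikCubicClassGroupsDegreeOnePrimesEscapeLowerShadow.lean`) — **the lower shadow from TZ + inexplicit
Stark**: for every `n > 1` a `C₁ = C₁(n)` with `29·Li(x) ≤ 32·π_K(x)` for every `K` of degree `n` without quadratic subfield
and `x ≥ Q^{C₁}` (the `β₁`-terms cancel unless `χ₁ = 1`, and then Stark pushes `β₁` below `1 − c/log|d_K|`). -/
theorem stub_lowerShadow : ThornerZaman2019_classPNT_hilbertClassField →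
    (∀ n : ℕ, ∃ c : ℝ, 0 < c ∧ ∀ (K : Type) [Field K] [NumberField K], Module.finrank ℚ K = n →
      (∀ F : IntermediateField ℚ K, Module.finrank ℚ F ≠ 2) →
      ∀ σ : ℝ, 1 - c / Real.log ((NumberField.discr K).natAbs : ℝ) ≤ σ → σ < 1 →
        dedekindZetaCont K σ ≠ 0) →
    ∀ n : ℕ, 1 < n → ∃ C₁ : ℝ, ∀ (K : Type) [Field K] [NumberField K], Module.finrank ℚ K = n →
      (∀ F : IntermediateField ℚ K, Module.finrank ℚ F ≠ 2) →
      ∀ x : ℝ, ThornerZaman.condQn K ^ C₁ ≤ x →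
        29 * offsetLogIntegral x ≤ 32 * (primeIdealCount K x : ℝ) :=
  Summit.QuantumAdvantage.QuantumAdvantage.Theorems.DegreeOnePrimesEscape.stub_lowerShadow

/-- STUB 9 (LANDED p84223, `Theorems/LinnikCubicClassGroupsDegreeOnePrimesEscapeComposition.lean`) — **the composition** (pure counting; its conclusion is
the crux UNFOLDED verbatim — a stub must not conclude the crux by name, the skeleton audit would take it for the composition —, definitionally the crux):
upper shadow → lower shadow → the crux UNFOLDED (definitionally the crux; outside `M` ≥ (29/32)Li − n·π(√x) − (33/64)Li since `[Cl:M] ≥ 2`;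
`π(x) ≤ 2 log 4 · x/log x + √x`; `Q ≤ |d_K|^{1+n²}`; degenerate degrees `n ≤ 2` vacuous). -/
theorem stub_shadowsComposition :
    (∃ C₀ : ℝ, ∀ (K : Type) [Field K] [NumberField K], 1 < Module.finrank ℚ K →
      ∀ x : ℝ, ThornerZaman.condQn K ^ C₀ ≤ x →
      ∀ M : Subgroup (ClassGroup (𝓞 K)),
        32 * (M.index : ℝ) *
            (Set.ncard {P : Ideal (𝓞 K) | P.IsPrime ∧ (Ideal.absNorm P : ℝ) ≤ x ∧
                ∃ hP : P ∈ (Ideal (𝓞 K))⁰, ClassGroup.mk0 ⟨P, hP⟩ ∈ M} : ℝ)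
          ≤ 33 * offsetLogIntegral x) →
    (∀ n : ℕ, 1 < n → ∃ C₁ : ℝ, ∀ (K : Type) [Field K] [NumberField K], Module.finrank ℚ K = n →
      (∀ F : IntermediateField ℚ K, Module.finrank ℚ F ≠ 2) →
      ∀ x : ℝ, ThornerZaman.condQn K ^ C₁ ≤ x →
        29 * offsetLogIntegral x ≤ 32 * (primeIdealCount K x : ℝ)) →
    (∀ n : ℕ, ∃ C : ℕ, ∀ (K : Type) [Field K] [NumberField K], Module.finrank ℚ K = n →
      (∀ F : IntermediateField ℚ K, Module.finrank ℚ F ≠ 2) → ∀ x : ℕ, |NumberField.discr K| ^ C ≤ (x : ℤ) →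
      ∀ M : Subgroup (ClassGroup (NumberField.RingOfIntegers K)), M ≠ ⊤ →
        Nat.primeCounting x ≤ 8 * Set.ncard {P : Ideal (NumberField.RingOfIntegers K) | P.IsPrime ∧
          (Ideal.absNorm P).Prime ∧ Ideal.absNorm P ≤ x ∧
          ∃ hP : P ∈ nonZeroDivisors (Ideal (NumberField.RingOfIntegers K)), ClassGroup.mk0 ⟨P, hP⟩ ∉ M}) :=
  Summit.QuantumAdvantage.QuantumAdvantage.Theorems.DegreeOnePrimesEscape.stub_shadowsComposition

/-! ### Consistency: each named statement IS its registered stub (definitionally) -/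

theorem s3DedekindRelation_holds : S3DedekindRelation := stub_dedekindRelation
theorem cubicClosureBound_holds : CubicClosureBound := stub_cubicClosure
theorem collisionTransfer_holds : CollisionTransfer := stub_collisionTransfer
theorem cubicZeroFreeGalois_holds : CubicZeroFreeGalois := stub_galoisCubicZeroFree
theorem starkResidue_holds : StarkResidue := stub_starkResidue
theorem upperShadow_of_TZ : ThornerZaman2019_classPNT_hilbertClassField → UpperShadow := stub_upperShadow
theorem classPNTAdditive_holds : ClassPNTAdditive := stub_classPNTAdditive
theorem classPNTAdditive_of_TZ : ThornerZaman2019_classPNT_hilbertClassField → ClassPNTAdditive := stub_additiveOfTZ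
theorem upperShadow_of_additive : ClassPNTAdditive → UpperShadow := stub_upperShadowAdd
theorem lowerShadow_of_additive_stark : ClassPNTAdditive → (∀ n : ℕ, StarkAt n) → LowerShadow := stub_lowerShadowAdd
theorem lowerShadow_of_TZ_stark :
    ThornerZaman2019_classPNT_hilbertClassField → (∀ n : ℕ, StarkAt n) → LowerShadow := stub_lowerShadow

/-- Wiring check: the registered stubs feed `DegreeOnePrimesEscape_of` as stated. -/
example : Summit.QuantumAdvantage.QuantumAdvantage.Theses.LinnikCubicClassGroups.DegreeOnePrimesEscape :=
  DegreeOnePrimesEscape_of stub_classPNTAdditive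

/-- Hence the crux needs only the additive class PNT; and the printed Thorner–Zaman fact still suffices (stub 10). -/
example (hTZ : Registered.stub_thornerZaman) :
    Summit.QuantumAdvantage.QuantumAdvantage.Theses.LinnikCubicClassGroups.DegreeOnePrimesEscape :=
  DegreeOnePrimesEscape_of (stub_additiveOfTZ hTZ)

/-- The TZ route is itself fully landed (stubs 7, 8: `stub_upperShadow`, `stub_lowerShadow`). -/
example (hTZ : Registered.stub_thornerZaman) :
    Summit.QuantumAdvantage.QuantumAdvantage.Theses.LinnikCubicClassGroups.DegreeOnePrimesEscape :=
  Summit.QuantumAdvantage.QuantumAdvantage.Theorems.DegreeOnePrimesEscape.stub_shadowsComposition (Summit.QuantumAdvantage.QuantumAdvantage.Theorems.DegreeOnePrimesEscape.stub_upperShadow hTZ)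
    (Summit.QuantumAdvantage.QuantumAdvantage.Theorems.DegreeOnePrimesEscape.stub_lowerShadow hTZ (starkAt_all (starkAt_three_of_cubic
      (Summit.QuantumAdvantage.QuantumAdvantage.Theorems.DegreeOnePrimesEscape.stub_collisionTransfer Summit.QuantumAdvantage.QuantumAdvantage.Theorems.DegreeOnePrimesEscape.stub_dedekindRelation
        Summit.QuantumAdvantage.QuantumAdvantage.Theorems.DegreeOnePrimesEscape.stub_cubicClosure) stub_galoisCubicZeroFree) Summit.QuantumAdvantage.QuantumAdvantage.Theorems.DegreeOnePrimesEscape.stub_starkResidue))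

/-! ### Scratch checks against the landed `Negative/*` lemmas and the `Leans on:` names -/

-- Landed negative lemma (p69750, `Negative/WithoutProperFalse.lean`): `M ≠ ⊤` is load-bearing — honoured inside the
-- composition (stub 9 uses `[Cl:M] ≥ 2`); not imported here (its relocated Prop lives in `Literature.Uncategorized`).

/-- `Leans on` (stub 3/4): the uniform simplicity theorem, PROVED in the tree, in the exact shape used. -/
example (n : ℕ) : ∃ c : ℝ, 0 < c ∧ ∀ (K : Type) [Field K] [NumberField K], Module.finrank ℚ K = n →
    ∀ β : ℝ, (2 : ℕ∞) ≤ analyticOrderAt (dedekindZeta₁ K) β →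
      β ≤ 1 - c / (Real.log ((NumberField.discr K).natAbs : ℝ) + Real.log 4) :=
  exists_realZero_simple_dedekindZeta₁ n

/-- `Leans on` (bypass / stub 5): the explicit named fact implies the inexplicit one. -/
example : Stark1974_dedekindZeta_ne_zero_of_noQuadraticSubfield → ∀ n : ℕ, StarkAt n :=
  starkAt_of_named

/-- **Where the line stands**: ALL stubs except the Thorner–Zaman fact are LANDED; the Stark named fact is PROVED in the tree
(`StarkNoQuadraticSubfieldProofs.lean`, this line), so the old two-fact conditional needs only TZ. -/
example : Stark1974_dedekindZeta_ne_zero_of_noQuadraticSubfield :=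
  Stark1974_dedekindZeta_ne_zero_of_noQuadraticSubfield_holds

end Summit.QuantumAdvantage.QuantumAdvantage.Cruxes.DegreeOnePrimesEscape.DedekindS3Collision

end
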